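import Mathlib

/-!
# `HurwitzSectorComplement` (stmt-KontsevichZagierPeriods-14341), line `galois-parity-half`,
# stub S1 `stub_symReduction` — part 2/4: Kubert generation over `ℚ` and symmetric folding

Pure linear algebra over an abstract `ℚ`-module `V` (no integrals). A family `e : ZMod L → V`
satisfies the weight-`w` DISTRIBUTION RELATIONS at the primes if
`p^w • e (p • z) = Σ_{p • y = p • z} e y` for every prime `p ∣ L` and every `z` (for the Hurwitz
kernels `e x = [t^{b}/(1 − t^L)]`, `x = b + 1`, these are the dilation moves `xᵢ ↦ xᵢ^p`).

* `kubert_mem_span` — **Kubert generation over `ℚ`**: every `e x` lies in the `ℚ`-span of the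
  `e u` with `u` of exact (additive) order `L`. Downward induction on the order `d` of `x`: for a
  prime `p ∣ L/d`, if `p ∣ d` all `p`-preimages of `x` have order `pd`; if `p ∤ d` then
  `e x' ≡ p^w e (p • x')` for all `x'` of order `d` (the other preimages of `p • x'` have order `pd`),
  and iterating `φ(d)` times closes the cycle (`p^{φ(d)} ≡ 1 mod d`), giving
  `(1 − p^{wφ(d)}) e x ≡ 0` with `p^{wφ(d)} ≠ 1`.
* `dist_symm`, `sum_smul_eq_half_symm`, `span_prim_le` — the symmetrised family
  `x ↦ e x + ε e (−x)` (`ε = ±1`) again satisfies the relations; a symmetric coefficient vector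
  pairs into it; the points of order `L` are `±a`, `a ∈ T_L = {0 < a < L/2, gcd(a, L) = 1}` (`L ≥ 3`).
* `symReduction_kubert` — the packaged statement (registered sub-goal): for symmetric `ρ`,
  `Σ_x ρ x • e x = Σ_{a ∈ T_L} μ a • (e a + ε • e (−a))`.

References: D. Kubert, *The universal ordinary distribution*, Bull. SMF 107 (1979); S. Lang,
*Cyclotomic Fields I–II* (1990), Ch. 2 §8–9; J. Milnor, Enseign. Math. 29 (1983), §1.
-/

open scoped BigOperators

namespace Summit.KontsevichZagierPeriods.Theorems.HurwitzMicroSectorsHurwitzSectorComplement.SymReduction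

variable {L : ℕ} [NeZero L] {V : Type*} [AddCommGroup V] [Module ℚ V]

/-! ## Orders of `p`-preimages in `ZMod L` -/

/-- For a prime `p`, the order of `y` is either the order of `p • y` (and then prime to `p`) or
`p` times it. [folklore] -/
theorem addOrderOf_of_prime_nsmul {p : ℕ} (hp : p.Prime) (y : ZMod L) :
    (addOrderOf y = addOrderOf (p • y) ∧ ¬ p ∣ addOrderOf y) ∨
      addOrderOf y = p * addOrderOf (p • y) := by
  have h : addOrderOf (p • y) = addOrderOf y / Nat.gcd (addOrderOf y) p := addOrderOf_nsmul y
  rcases (Nat.dvd_prime hp).mp (Nat.gcd_dvd_right (addOrderOf y) p) with h1 | h2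
  · left
    refine ⟨by rw [h, h1, Nat.div_one], fun hpd => ?_⟩
    have : p ∣ Nat.gcd (addOrderOf y) p := Nat.dvd_gcd hpd dvd_rfl
    rw [h1] at this
    exact hp.one_lt.ne' (Nat.dvd_one.mp this)
  · right
    have hpd : p ∣ addOrderOf y := h2 ▸ Nat.gcd_dvd_left _ _
    rw [h, h2, Nat.mul_div_cancel' hpd]

omit [NeZero L] in
/-- Two elements of the same order `d` prime to `p` with the same `p`-multiple coincide. [folklore] -/
theorem eq_of_nsmul_eq_of_coprime {p : ℕ} {y x : ZMod L} (h : p • y = p • x)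
    (hy : addOrderOf y = addOrderOf x) (hcop : Nat.Coprime p (addOrderOf x)) : y = x := by
  have h1 : addOrderOf (y - x) ∣ p := by
    rw [addOrderOf_dvd_iff_nsmul_eq_zero, smul_sub, h, sub_self]
  have h2 : addOrderOf (y - x) ∣ addOrderOf x := by
    have h3 := (AddCommute.all y (-x)).addOrderOf_add_dvd_lcm
    rw [addOrderOf_neg, hy, Nat.lcm_self, ← sub_eq_add_neg] at h3
    exact h3
  have h4 : addOrderOf (y - x) = 1 := Nat.eq_one_of_dvd_coprimes hcop h1 h2
  rwa [AddMonoid.addOrderOf_eq_one_iff, sub_eq_zero] at h4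

/-! ## Kubert generation over `ℚ` -/

/-- **Kubert generation over `ℚ`.** If `e : ZMod L → V` satisfies the weight-`w` distribution
relations at the primes (`w ≥ 1`), then every `e x` is a `ℚ`-combination of the `e u` with `u` of
exact order `L`. [cite: Lang1990, Ch. 2 §8] -/
theorem kubert_mem_span {w : ℕ} (hw : 1 ≤ w) (e : ZMod L → V)
    (hDist : ∀ p : ℕ, p.Prime → p ∣ L → ∀ z : ZMod L, ((p : ℚ) ^ w) • e (p • z) =
      ∑ y ∈ Finset.univ.filter (fun y : ZMod L => p • y = p • z), e y)
    (x : ZMod L) : e x ∈ Submodule.span ℚ (e '' {u : ZMod L | addOrderOf u = L}) := by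
  suffices h : ∀ n : ℕ, ∀ x : ZMod L, L - addOrderOf x = n →
      e x ∈ Submodule.span ℚ (e '' {u : ZMod L | addOrderOf u = L}) from h _ x rfl
  intro n
  induction n using Nat.strong_induction_on with
  | _ n ih =>
  intro x hx
  set U := Submodule.span ℚ (e '' {u : ZMod L | addOrderOf u = L}) with hU
  have hL0 : L ≠ 0 := NeZero.ne L
  have hordL : ∀ y : ZMod L, addOrderOf y ∣ L := fun y =>
    (addOrderOf_dvd_card (x := y)).trans (by rw [ZMod.card])
  set d := addOrderOf x with hd
  have hd0 : 0 < d := addOrderOf_pos x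
  have hdL : d ∣ L := hordL x
  by_cases hdl : d = L
  · exact Submodule.subset_span ⟨x, hdl, rfl⟩
  have hdle : d ≤ L := Nat.le_of_dvd (Nat.pos_of_ne_zero hL0) hdL
  obtain ⟨c, hc⟩ := hdL
  have hc1 : c ≠ 1 := by
    rintro rfl
    rw [mul_one] at hc
    exact hdl hc.symm
  obtain ⟨p, hp, hpc⟩ := Nat.exists_prime_and_dvd hc1
  have hpL : p ∣ L := hc ▸ dvd_mul_of_dvd_right hpc d
  have hp2 := hp.two_le
  -- the induction hypothesis applies to every element of order `p * d`
  have hIH : ∀ y : ZMod L, addOrderOf y = p * d → e y ∈ U := fun y hy => by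
    have h1 : p * d ≤ L := hy ▸ Nat.le_of_dvd (Nat.pos_of_ne_zero hL0) (hordL y)
    have h2 : 2 * d ≤ p * d := Nat.mul_le_mul_right d hp2
    exact ih (L - addOrderOf y) (by rw [hy]; omega) y rfl
  by_cases hpd : p ∣ d
  · -- every `p`-preimage of `x` has order `p d`
    obtain ⟨z, rfl⟩ : ∃ z : ZMod L, x = p • z := by
      have h1 : d • x = 0 := addOrderOf_nsmul_eq_zero x
      have h2 : ((d * x.val : ℕ) : ZMod L) = 0 := by
        rw [Nat.cast_mul, ZMod.natCast_zmod_val, ← nsmul_eq_mul, h1]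
      rw [ZMod.natCast_eq_zero_iff] at h2
      have h3 : d * c ∣ d * x.val := by rw [← hc]; exact h2
      obtain ⟨m, hm⟩ := hpc.trans (Nat.dvd_of_mul_dvd_mul_left hd0 h3)
      refine ⟨(m : ZMod L), ?_⟩
      rw [nsmul_eq_mul, ← Nat.cast_mul, ← hm, ZMod.natCast_zmod_val]
    have hmem : ((p : ℚ) ^ w) • e (p • z) ∈ U := by
      rw [hDist p hp hpL z]
      refine Submodule.sum_mem _ fun y hy => ?_
      rw [Finset.mem_filter] at hy
      rcases addOrderOf_of_prime_nsmul hp y with ⟨h, hnd⟩ | h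
      · exact absurd (h ▸ hy.2.symm ▸ hpd) hnd
      · exact hIH y (by rw [h, hy.2])
    have hp0 : ((p : ℚ) ^ w) ≠ 0 := pow_ne_zero _ (Nat.cast_ne_zero.mpr hp.ne_zero)
    exact (Submodule.smul_mem_iff U hp0).mp hmem
  · -- `p ∤ d`: cycle inside the elements of order `d`
    have hcop : Nat.Coprime p d := (Nat.Prime.coprime_iff_not_dvd hp).mpr hpd
    have step : ∀ x' : ZMod L, addOrderOf x' = d →
        e x' - ((p : ℚ) ^ w) • e (p • x') ∈ U := by
      intro x' hx'
      have hpx' : addOrderOf (p • x') = d := by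
        rcases addOrderOf_of_prime_nsmul hp x' with ⟨h, -⟩ | h
        · rw [← h, hx']
        · exact absurd (Dvd.intro _ (h.symm.trans hx')) hpd
      rw [hDist p hp hpL x', ← Finset.add_sum_erase
        (Finset.univ.filter (fun y : ZMod L => p • y = p • x')) e
        (Finset.mem_filter.mpr ⟨Finset.mem_univ x', rfl⟩), sub_add_eq_sub_sub, sub_self, zero_sub]
      refine U.neg_mem (Submodule.sum_mem _ fun y hy => ?_)
      rw [Finset.mem_erase, Finset.mem_filter] at hy
      rcases addOrderOf_of_prime_nsmul hp y with ⟨h, -⟩ | h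
      · exact absurd (eq_of_nsmul_eq_of_coprime hy.2.2 (by rw [h, hy.2.2, hpx', hx'])
          (hx'.symm ▸ hcop)) hy.1
      · exact hIH y (by rw [h, hy.2.2, hpx'])
    have iter : ∀ k : ℕ, ∀ x' : ZMod L, addOrderOf x' = d →
        e x' - (((p : ℚ) ^ w) ^ k) • e (p ^ k • x') ∈ U := by
      intro k
      induction k with
      | zero =>
        intro x' _
        rw [pow_zero, pow_zero, one_smul, one_smul, sub_self]
        exact U.zero_mem
      | succ k ihk =>
        intro x' hx'
        have hk : addOrderOf (p ^ k • x') = d := by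
          rw [addOrderOf_nsmul, hx', Nat.Coprime.gcd_eq_one (Nat.Coprime.pow_right k hcop.symm),
            Nat.div_one]
        have e1 : e x' - (((p : ℚ) ^ w) ^ (k + 1)) • e (p ^ (k + 1) • x') =
            (e x' - (((p : ℚ) ^ w) ^ k) • e (p ^ k • x')) +
              (((p : ℚ) ^ w) ^ k) • (e (p ^ k • x') - ((p : ℚ) ^ w) • e (p • (p ^ k • x'))) := by
          rw [smul_sub, smul_smul, smul_smul, ← pow_succ, ← pow_succ']
          abel
        rw [e1]
        exact U.add_mem (ihk x' hx') (U.smul_mem _ (step _ hk))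
    have hfix : p ^ d.totient • x = x := by
      have h0 : 1 ≤ p ^ d.totient := Nat.one_le_pow _ _ hp.pos
      have h1 : d ∣ p ^ d.totient - 1 :=
        (Nat.modEq_iff_dvd' h0).mp (Nat.ModEq.pow_totient hcop).symm
      have h2 : (p ^ d.totient - 1) • x = 0 := addOrderOf_dvd_iff_nsmul_eq_zero.mp h1
      calc p ^ d.totient • x = (p ^ d.totient - 1 + 1) • x := by rw [Nat.sub_add_cancel h0]
        _ = x := by rw [add_nsmul, h2, one_nsmul, zero_add]
    have hmem := iter d.totient x rfl
    rw [hfix, ← one_smul ℚ (e x), smul_smul, mul_one, ← sub_smul] at hmem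
    have hne : (1 : ℚ) - ((p : ℚ) ^ w) ^ d.totient ≠ 0 := by
      rw [sub_ne_zero, ← pow_mul]
      have h1 : (1 : ℚ) < (p : ℚ) ^ (w * d.totient) :=
        one_lt_pow₀ (by exact_mod_cast hp.one_lt)
          (Nat.mul_ne_zero (by omega) (Nat.totient_pos.mpr hd0).ne')
      exact h1.ne
    exact (Submodule.smul_mem_iff U hne).mp hmem

/-! ## Symmetric folding -/

/-- The distribution relations are stable under the point involution `x ↦ −x`: the symmetrised
family `x ↦ e x + ε • e (−x)` satisfies them again. [folklore] -/
theorem dist_symm {w : ℕ} (e : ZMod L → V)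
    (hDist : ∀ p : ℕ, p.Prime → p ∣ L → ∀ z : ZMod L, ((p : ℚ) ^ w) • e (p • z) =
      ∑ y ∈ Finset.univ.filter (fun y : ZMod L => p • y = p • z), e y) (ε : ℚ) :
    ∀ p : ℕ, p.Prime → p ∣ L → ∀ z : ZMod L, ((p : ℚ) ^ w) • (e (p • z) + ε • e (-(p • z))) =
      ∑ y ∈ Finset.univ.filter (fun y : ZMod L => p • y = p • z), (e y + ε • e (-y)) := by
  intro p hp hpL z
  have hre : ∑ y ∈ Finset.univ.filter (fun y : ZMod L => p • y = p • z), e (-y) =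
      ∑ y ∈ Finset.univ.filter (fun y : ZMod L => p • y = p • (-z)), e y := by
    rw [Finset.sum_filter, Finset.sum_filter]
    refine Fintype.sum_equiv (Equiv.neg (ZMod L)) _ _ fun y => ?_
    simp only [Equiv.neg_apply, smul_neg, neg_inj]
  rw [Finset.sum_add_distrib, smul_add, hDist p hp hpL z, ← Finset.smul_sum, hre, ← smul_neg,
    smul_comm ((p : ℚ) ^ w) ε, hDist p hp hpL (-z)]

/-- A symmetric coefficient vector pairs into the symmetrised family:
`Σ ρ x • e x = ½ Σ ρ x • (e x + ε e (−x))` when `ρ (−x) = ε ρ x`, `ε² = 1`. [folklore] -/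
theorem sum_smul_eq_half_symm (e : ZMod L → V) (ε : ℚ) (hε : ε * ε = 1) (ρ : ZMod L → ℚ)
    (hρ : ∀ x, ρ (-x) = ε * ρ x) :
    ∑ x : ZMod L, ρ x • e x = (1 / 2 : ℚ) • ∑ x : ZMod L, ρ x • (e x + ε • e (-x)) := by
  have h1 : ∑ x : ZMod L, ρ x • e (-x) = ε • ∑ x : ZMod L, ρ x • e x := by
    rw [Finset.smul_sum]
    refine Fintype.sum_equiv (Equiv.neg (ZMod L)) _ _ fun x => ?_
    rw [Equiv.neg_apply, smul_smul, hρ, ← mul_assoc, hε, one_mul]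
  simp_rw [smul_add, Finset.sum_add_distrib, smul_comm (ρ _) ε, ← Finset.smul_sum, h1, smul_smul, hε,
    one_smul, ← two_smul ℚ, smul_smul]
  norm_num

/-- For `L ≥ 3` the points of exact order `L` are `±a` with `a ∈ T_L = {0 < a < L/2, gcd(a,L) = 1}`,
so for a family with `f (−u) = ε • f u` the span of the `f u`, `u` of order `L`, lies in the span of
the `f a`, `a ∈ T_L`. [folklore] -/
theorem span_prim_le (hL : 3 ≤ L) (f : ZMod L → V) (ε : ℚ) (hf : ∀ u, f (-u) = ε • f u) :
    Submodule.span ℚ (f '' {u : ZMod L | addOrderOf u = L}) ≤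
      Submodule.span ℚ (Set.range fun a : (Finset.range L).filter
        (fun a => 2 * a < L ∧ Nat.Coprime a L) => f ((a : ℕ) : ZMod L)) := by
  refine Submodule.span_le.mpr ?_
  rintro _ ⟨u, hu, rfl⟩
  have hu' : addOrderOf u = L := hu
  have hval : u.val < L := ZMod.val_lt u
  have hcop : Nat.Coprime u.val L := by
    have h := ZMod.addOrderOf_coe u.val (NeZero.ne L)
    rw [ZMod.natCast_zmod_val, hu'] at h
    have hg : 0 < Nat.gcd L u.val := Nat.gcd_pos_of_pos_left _ (by omega)
    have h1 : Nat.gcd L u.val = 1 := by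
      by_contra hne
      have h2 : L / Nat.gcd L u.val < L := Nat.div_lt_self (by omega) (by omega)
      omega
    exact Nat.Coprime.symm h1
  have h0 : u.val ≠ 0 := fun h => by
    rw [h, Nat.coprime_zero_left] at hcop
    omega
  have h2ne : 2 * u.val ≠ L := fun h => by
    have : u.val = 1 := hcop.eq_one_of_dvd (Dvd.intro_left 2 h)
    omega
  rcases Nat.lt_or_gt_of_ne h2ne with hlt | hgt
  · have ha : u.val ∈ (Finset.range L).filter (fun a => 2 * a < L ∧ Nat.Coprime a L) :=
      Finset.mem_filter.mpr ⟨Finset.mem_range.mpr hval, hlt, hcop⟩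
    have : f u = f ((u.val : ℕ) : ZMod L) := by rw [ZMod.natCast_zmod_val]
    rw [this]
    exact Submodule.subset_span ⟨⟨u.val, ha⟩, rfl⟩
  · have ha : L - u.val ∈ (Finset.range L).filter (fun a => 2 * a < L ∧ Nat.Coprime a L) :=
      Finset.mem_filter.mpr ⟨Finset.mem_range.mpr (by omega), by omega,
        (Nat.coprime_self_sub_left hval.le).mpr hcop⟩
    have hu2 : u = -(((L - u.val : ℕ)) : ZMod L) := by
      rw [Nat.cast_sub hval.le, ZMod.natCast_self, zero_sub, neg_neg, ZMod.natCast_zmod_val]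
    rw [hu2, hf]
    exact Submodule.smul_mem _ _ (Submodule.subset_span ⟨⟨L - u.val, ha⟩, rfl⟩)

/-! ## The packaged statement (registered sub-goal `symReduction_kubert`) -/

/-- **Kubert generation with symmetric folding.** Let `e : ZMod L → V` (`L ≥ 3`, `V` a `ℚ`-module)
satisfy the weight-`w` distribution relations at the primes (`w ≥ 1`), let `ε = ±1` and let
`ρ : ZMod L → ℚ` be `ε`-symmetric (`ρ (−x) = ε ρ x`). Then
`Σ_x ρ x • e x = Σ_{a ∈ T_L} μ a • (e a + ε • e (−a))` for some rational `μ`,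
`T_L = {0 < a < L/2, gcd(a, L) = 1}`: pair `ρ` into the symmetrised family (which satisfies the
relations again), generate it by its values at the points of order `L` (Kubert), and fold `±a`.
[cite: Lang1990, Ch. 2 §8] -/
theorem symReduction_kubert : ∀ (L w : ℕ) [NeZero L], 3 ≤ L → 1 ≤ w → ∀ (V : Type) [AddCommGroup V] [Module ℚ V] (e : ZMod L → V), (∀ p : ℕ, p.Prime → p ∣ L → ∀ z : ZMod L, ((p : ℚ) ^ w) • e (p • z) = ∑ y ∈ Finset.univ.filter (fun y : ZMod L => p • y = p • z), e y) → ∀ (ε : ℚ), ε * ε = 1 → ∀ (ρ : ZMod L → ℚ), (∀ x : ZMod L, ρ (-x) = ε * ρ x) → ∃ μ : ℕ → ℚ, ∑ x : ZMod L, ρ x • e x = ∑ a ∈ (Finset.range L).filter (fun a => 2 * a < L ∧ Nat.Coprime a L), μ a • (e (a : ZMod L) + ε • e (-(a : ZMod L))) := by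
  intro L w _ hL hw V _ _ e hDist ε hε ρ hρ
  obtain ⟨es, hes⟩ : ∃ es : ZMod L → V, ∀ x, es x = e x + ε • e (-x) := ⟨_, fun _ => rfl⟩
  have hDs : ∀ p : ℕ, p.Prime → p ∣ L → ∀ z : ZMod L, ((p : ℚ) ^ w) • es (p • z) =
      ∑ y ∈ Finset.univ.filter (fun y : ZMod L => p • y = p • z), es y := by
    simp only [hes]
    exact dist_symm e hDist ε
  have hsymm : ∀ u, es (-u) = ε • es u := fun u => by
    rw [hes, hes, neg_neg, smul_add, smul_smul, hε, one_smul, add_comm]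
  have hle := span_prim_le hL es ε hsymm
  have hsum : ∑ x : ZMod L, ρ x • e x ∈ Submodule.span ℚ (Set.range fun a : (Finset.range L).filter
      (fun a => 2 * a < L ∧ Nat.Coprime a L) => es ((a : ℕ) : ZMod L)) := by
    rw [sum_smul_eq_half_symm e ε hε ρ hρ]
    refine Submodule.smul_mem _ _ (Submodule.sum_mem _ fun x _ => Submodule.smul_mem _ _ (hle ?_))
    rw [← hes]
    exact kubert_mem_span hw es hDs x
  obtain ⟨c, hc⟩ := (Submodule.mem_span_range_iff_exists_fun ℚ).mp hsum
  classical
  refine ⟨fun a => if h : a ∈ (Finset.range L).filter (fun a => 2 * a < L ∧ Nat.Coprime a L)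
    then c ⟨a, h⟩ else 0, ?_⟩
  rw [← hc, ← Finset.sum_coe_sort ((Finset.range L).filter (fun a => 2 * a < L ∧ Nat.Coprime a L))]
  refine Finset.sum_congr rfl fun i _ => ?_
  simp only [dif_pos i.2, hes]

end Summit.KontsevichZagierPeriods.Theorems.HurwitzMicroSectorsHurwitzSectorComplement.SymReduction
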